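import Summits.BirchSwinnertonDyer.BirchSwinnertonDyer.Theorems.GenusKolyvaginAtTwoPowDvdShaCardAtTwoRTKolyvaginSuppliesOfDeepSwap
import Summits.BirchSwinnertonDyer.BirchSwinnertonDyer.Theorems.GenusKolyvaginAtTwoPowDvdShaCardAtTwoPosTKolyvaginMinimaPredTransposition
import HarnessLib

/-!
# Route `GenusKolyvaginAtTwo`, crux L⁺_T `PowDvdShaCardAtTwoPosT` (stmt-BirchSwinnertonDyer-23379), road (E4)⁺, stub KS⁺ — THE KS ASSEMBLY
# WITH THE CLASS PREDICATE KEPT IN THE OUTPUT, OVER THE TRANSPOSITION CLASS, SIGN-FREE IN `Δ`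
# (gk2-p2 g20's `kolyvaginSuppliesAtTwo_of_deepSwap_pred` with `Δ < 0`, `hns` deleted and `hG`'s Gross clause ↦ the transposition clause)

Seat `bsd-line-gk2-p5` g32 (WIDTH-5 attach, cell `bsd-f1-sign2`), `--supports stmt-BirchSwinnertonDyer-23379` (helper; closes nothing).
THEOREMS ONLY (no definition, no named fact, no `sorry`); BSD is not proved by any of this; neither is L⁺_T nor stub KS⁺.

WHAT (LEAD gk2-p1 g20 memo R10 §0.3 / §2(e), ruling R10′).  **`kolyvaginSuppliesAtTwo_of_deepSwap_pred_transposition`** = gk2-p2 g20's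
`kolyvaginSuppliesAtTwo_of_deepSwap_pred` (`…RTKolyvaginSuppliesOfDeepSwapPred`; = g19's `kolyvaginSuppliesAtTwo_of_deepSwap` with provenance) —
Kolyvagin's minima, the bottom rung `hbot`, the deep swap `hswap`, the eigen index law `hK`, McCallum's record clause
(`exists_recordLevel_avoiding_of_deepSwap`, sign-free already) ⟹ the KS conclusion (`R`, `Mr`, `hOdd`, `hEven` with disjointness and the primes
of the supplied levels reported in the class `ZK ∧ L ≤ idx ∧ G`) — with the two `Δ < 0` tokens removed: `(hΔ : W.Δ < 0)` and `hns` are DELETED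
and the class predicate is declared through the TRANSPOSITION clause,
`hG : ZK q → L + k ≤ idx q → (∃ v 𝔓 h, q ∈ v ∧ 𝔓 ∈ v.primesAbove ∧ IsArithFrobAt (𝓞 ℚ) h 𝔓 ∧ ∃ u : E[2], h • u ≠ u) → G q`;
the minima are `RelaxedCount.exists_kolyvaginMinima_pred_transposition` (`…PosTKolyvaginMinimaPredTransposition`); proof otherwise VERBATIM.
With `G q := L + k ≤ idx q ∧ TRANSP q` the socket `hswap` is `deepSwap_socket_transposition` (`…PosTDeepSwapSocketTransposition`, this seat);
`hbot` / `hK` at transposition-deep primes are gk2-p3's / gk2-p4's ports (R10′).  This is the (E4)⁺ analogue of the input of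
`kolyvaginSuppliesAtTwo_of_grossWitness_onHabitat_pred` one level up.

References: [McCallumLMS1991] §5 Prop. 5.2, Lemma 5.1, Thm. 5.4, §4 Prop. 4.4, Cor. 4.5, Lemma 4.6; [Kolyvagin1991MathAnn] Thm. 2.1–2.2;
[GrossLMS1991] §3 (3.1)–(3.3), §4 (4.1), Prop. 5.3.
-/

set_option autoImplicit false
-- the Theorems namespace of this sub repeats the summit name by design (D-0017 nested layout)
set_option linter.dupNamespace false

noncomputable section

open scoped Classical

namespace Summit.BirchSwinnertonDyer.BirchSwinnertonDyer.Theorems.GenusExact.PlusDescent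

open WeierstrassCurve NumberField IsDedekindDomain Field Literature.NumberTheory.EllipticCurves
  Literature.NumberTheory.GaloisRepresentations Literature.NumberTheory.EllipticCurves.ModularForms AddSubgroup
open Summit.BirchSwinnertonDyer.BirchSwinnertonDyer.Theses.GenusKolyvaginAtTwo (KolyvaginRelationAtTwo)

variable {K : Type} [Field K] [NumberField K]

/-- **THE KS ASSEMBLY WITH PROVENANCE OVER THE TRANSPOSITION CLASS (any sign of `Δ`)**: the registered conclusion of
`stub_kolyvaginSystemAtTwo` at a given level `L` over the class `G` (declared through the transposition clause), the supplied levels' primes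
REPORTED IN THE CLASS (`ZK ∧ L ≤ idx ∧ G`), from the sign-free minima, a bottom rung `hbot`, the deep swap `hswap` and the eigen index law `hK`
— gk2-p2 g20's `kolyvaginSuppliesAtTwo_of_deepSwap_pred` with `Δ < 0`, `hns` deleted (proof adapted verbatim).
[cite: McCallumLMS1991, §5 Prop. 5.2, Lemma 5.1, §4 Cor. 4.5, Lemma 4.6] [cite: Kolyvagin1991MathAnn, Thm. 2.1] [cite: GrossLMS1991, §3 (3.1)–(3.3), §4 (4.1)] -/
theorem kolyvaginSuppliesAtTwo_of_deepSwap_pred_transposition (W : WeierstrassCurve ℚ) [W.IsElliptic] [W.IsGloballyMinimal]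
    [NeZero (W.conductorNorm ℤ)]
    (hQ2 : KolyvaginRelationAtTwo) (hcm : ¬ W.HasCM) (hT : Odd W.tamagawaProduct)
    (hρ : ∀ m : ℕ, W.HasSurjectiveModNGaloisRep (2 ^ m : ℕ))
    (hIQ : IsImaginaryQuadratic K) (hodd : Odd (NumberField.discr K)) (h3 : NumberField.discr K ≠ -3)
    (hHe : SatisfiesHeegnerHypothesis (W.conductorNorm ℤ) K)
    (τ : K ≃ₐ[ℚ] K) (hτ : τ ≠ 1)
    (Dt : ModularParametrizationData W (W.conductorNorm ℤ)) (β : ℤ) (ι : K →+* ℂ)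
    (d₁ : KolyvaginHeegnerData Dt β ι 1) (M₀ : ℕ)
    (hM₀ : ∃ Q : (W.baseChange (ringClassField K ι 1)).toAffine.Point, ((2 ^ M₀ : ℕ) : ℤ) • Q = d₁.derivedPoint)
    (hndiv : ¬ ∃ Q : (W.baseChange (ringClassField K ι 1)).toAffine.Point, ((2 ^ (M₀ + 1) : ℕ) : ℤ) • Q = d₁.derivedPoint)
    {L : ℕ} (hML : M₀ + 1 ≤ L) (k : ℕ)
    (hNPh : ∀ z : galH1Torsion (W.baseChange K) ((2 ^ (L + k) : ℕ) : ℤ),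
      (∀ ρ' ∈ torsionFixing (W.baseChange K) ((2 ^ (L + k) : ℕ) : ℤ), h1Eval (W.baseChange K) ((2 ^ (L + k) : ℕ) : ℤ) z ρ' = 0) →
      (∀ w : HeightOneSpectrum (𝓞 K), z ∈ selmerLocalKer (W.baseChange K) (w.adicCompletion K) ((2 ^ (L + k) : ℕ) : ℤ)) → z = 0)
    (G : ℕ → Prop)
    (hG : ∀ q : ℕ, Zhang2014.IsKolyvaginPrime (W.conductorNorm ℤ) W K 2 q → L + k ≤ Zhang2014.kolyvaginIndex W 2 q →
      (∃ (v₁ : HeightOneSpectrum (𝓞 ℚ)) (𝔓 : Ideal (absIntegers (𝓞 ℚ) ℚ)) (h : absoluteGaloisGroup ℚ),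
          (q : 𝓞 ℚ) ∈ v₁.asIdeal ∧ 𝔓 ∈ v₁.primesAbove ∧ IsArithFrobAt (𝓞 ℚ) h 𝔓 ∧ ∃ u : geomTorsion W 2, h • u ≠ u) → G q)
    (hbot : ∃ (n : ℕ) (d : KolyvaginHeegnerData Dt β ι n), Squarefree n ∧
      (∀ q ∈ n.primeFactors, (Zhang2014.IsKolyvaginPrime (W.conductorNorm ℤ) W K 2 q ∧ L ≤ Zhang2014.kolyvaginIndex W 2 q) ∧ G q) ∧
      addOrderOf (d.kolyvaginClass Nat.prime_two L) = 2 ^ L)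
    (hswap : ∀ (r m : ℕ), 1 ≤ r → m < M₀ →
      (∀ (n : ℕ) (e : KolyvaginHeegnerData Dt β ι n), Squarefree n → n.primeFactors.card = r →
        (∀ q ∈ n.primeFactors, (Zhang2014.IsKolyvaginPrime (W.conductorNorm ℤ) W K 2 q ∧ L ≤ Zhang2014.kolyvaginIndex W 2 q) ∧ G q) →
        ((2 ^ (L - m) : ℕ) : ℤ) • e.kolyvaginClass Nat.prime_two L = 0) →
      ∀ (n : ℕ) (d : KolyvaginHeegnerData Dt β ι n), Squarefree n → n.primeFactors.card = r →
      (∀ q ∈ n.primeFactors, (Zhang2014.IsKolyvaginPrime (W.conductorNorm ℤ) W K 2 q ∧ L ≤ Zhang2014.kolyvaginIndex W 2 q) ∧ G q) →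
      addOrderOf (d.kolyvaginClass Nat.prime_two L) = 2 ^ (L - m) →
      ∀ ℓ₀ ∈ n.primeFactors, ∀ X : Finset ℕ, ∃ ℓ' : ℕ, ℓ' ∉ X ∧ ℓ' ∉ n.primeFactors ∧
        ((Zhang2014.IsKolyvaginPrime (W.conductorNorm ℤ) W K 2 ℓ' ∧ L ≤ Zhang2014.kolyvaginIndex W 2 ℓ') ∧ G ℓ') ∧
        (∃ v : HeightOneSpectrum (𝓞 K), ((ℓ' : ℕ) : 𝓞 K) ∈ v.asIdeal ∧
          ((2 ^ (L - m - 1) : ℕ) : ℤ) • d.kolyvaginClass Nat.prime_two L ∉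
            (W.baseChange K).torsionLocalKer (v.adicCompletion K) ((2 ^ L : ℕ) : ℤ)) ∧
        ∃ d' : KolyvaginHeegnerData Dt β ι (ℓ' * (n / ℓ₀)),
          ((2 ^ (L - m - 1) : ℕ) : ℤ) • d'.kolyvaginClass Nat.prime_two L ≠ 0)
    (hK : ∀ (r ℓ : ℕ), (Zhang2014.IsKolyvaginPrime (W.conductorNorm ℤ) W K 2 ℓ ∧ L ≤ Zhang2014.kolyvaginIndex W 2 ℓ) ∧ G ℓ →
      ∀ C : AddSubgroup (galH1Torsion (W.baseChange K) ((2 ^ L : ℕ) : ℤ)),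
      (∀ c ∈ C, c ∈ selmerGroup (W.baseChange K) ((2 ^ L : ℕ) : ℤ) ∧
        conjAct W τ ((2 ^ L : ℕ) : ℤ) c = (-W.rootNumber * (-1) ^ r) • c) →
      (⨅ (v : HeightOneSpectrum (𝓞 K)) (_ : ((ℓ : ℕ) : 𝓞 K) ∈ v.asIdeal),
          (W.baseChange K).torsionLocalKer (v.adicCompletion K) ((2 ^ L : ℕ) : ℤ)).relIndex
        (C ⊓ AddSubgroup.torsionBy (galH1Torsion (W.baseChange K) ((2 ^ L : ℕ) : ℤ)) (2 : ℤ)) ∣ 2) :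
    ∃ (R : ℕ) (Mr : ℕ → ℕ), (∀ j, Mr (j + 1) ≤ Mr j) ∧ Mr 0 = M₀ ∧ Mr R = 0 ∧
      (∀ m : ℕ, Mr (2 * m + 1) < Mr (2 * m) →
        ∀ (i : ℕ) (u : Fin i → galH1Torsion (W.baseChange K) ((2 ^ L : ℕ) : ℤ)), i ≤ 2 * m + 1 →
        (∀ j, u j ∈ selmerGroup (W.baseChange K) ((2 ^ L : ℕ) : ℤ) ∧
          conjAct W τ ((2 ^ L : ℕ) : ℤ) (u j) = W.rootNumber • u j) →
        ∃ (n : ℕ) (_ : Squarefree n)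
          (_ : ∀ ℓ ∈ n.primeFactors, Zhang2014.IsKolyvaginPrime (W.conductorNorm ℤ) W K 2 ℓ ∧ L ≤ Zhang2014.kolyvaginIndex W 2 ℓ ∧ G ℓ)
          (d : KolyvaginHeegnerData Dt β ι n),
          (∀ ℓ ∈ n.primeFactors, ∀ e : KolyvaginHeegnerData Dt β ι (n / ℓ),
            ((2 ^ (L - Mr (2 * m)) : ℕ) : ℤ) • e.kolyvaginClass Nat.prime_two L = 0) ∧
          addOrderOf (d.kolyvaginClass Nat.prime_two L) = 2 ^ (L - Mr (2 * m + 1)) ∧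
          -W.rootNumber * (-1) ^ n.primeFactors.card = W.rootNumber ∧
          Disjoint (zmultiples (((2 ^ (L - Mr (2 * m)) : ℕ) : ℤ) • d.kolyvaginClass Nat.prime_two L))
            (AddSubgroup.closure (Set.range u))) ∧
      (∀ m : ℕ, Mr (2 * m + 2) < Mr (2 * m + 1) →
        ∀ (i : ℕ) (u : Fin i → galH1Torsion (W.baseChange K) ((2 ^ L : ℕ) : ℤ)), i ≤ 2 * m + 1 →
        (∀ j, u j ∈ selmerGroup (W.baseChange K) ((2 ^ L : ℕ) : ℤ) ∧
          conjAct W τ ((2 ^ L : ℕ) : ℤ) (u j) = (-W.rootNumber) • u j) →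
        ∃ (n : ℕ) (_ : Squarefree n)
          (_ : ∀ ℓ ∈ n.primeFactors, Zhang2014.IsKolyvaginPrime (W.conductorNorm ℤ) W K 2 ℓ ∧ L ≤ Zhang2014.kolyvaginIndex W 2 ℓ ∧ G ℓ)
          (d : KolyvaginHeegnerData Dt β ι n),
          (∀ ℓ ∈ n.primeFactors, ∀ e : KolyvaginHeegnerData Dt β ι (n / ℓ),
            ((2 ^ (L - Mr (2 * m + 1)) : ℕ) : ℤ) • e.kolyvaginClass Nat.prime_two L = 0) ∧
          addOrderOf (d.kolyvaginClass Nat.prime_two L) = 2 ^ (L - Mr (2 * m + 2)) ∧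
          -W.rootNumber * (-1) ^ n.primeFactors.card = -W.rootNumber ∧
          Disjoint (zmultiples (((2 ^ (L - Mr (2 * m + 1)) : ℕ) : ℤ) • d.kolyvaginClass Nat.prime_two L))
            (AddSubgroup.closure (Set.range u) ⊔ zmultiples (d₁.kolyvaginClass Nat.prime_two L))) := by
  have hL1 : 1 ≤ L := by omega
  have hn0 : ((2 ^ L : ℕ) : ℤ) ≠ 0 := by positivity
  have hne4 : NumberField.discr K ≠ -4 := fun h ↦ by
    rw [h] at hodd
    exact (Int.not_even_iff_odd.mpr hodd) ⟨-2, by norm_num⟩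
  have hsurj1 : W.HasSurjectiveModNGaloisRep ((2 : ℤ) ^ 1) := by exact_mod_cast hρ 1
  -- the minima over the class
  obtain ⟨Mr, hstep, hMr0, hMrL, hkill, hatt, hzero⟩ := RelaxedCount.exists_kolyvaginMinima_pred_transposition W hQ2 hcm hT hρ hIQ hodd
    h3 hHe τ hτ Dt β ι d₁ M₀ hM₀ hndiv hML k hNPh G hG
  have hanti : ∀ a b, a ≤ b → Mr b ≤ Mr a := fun a b hab ↦ by
    induction hab with
    | refl => exact le_rfl
    | step _ ih => exact (hstep _).trans ih
  have hMrM₀ : ∀ s, Mr s ≤ M₀ := fun s ↦ hMr0 ▸ hanti 0 s (Nat.zero_le s)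
  -- the bottom rung
  obtain ⟨nb, db, hnb, hadmb, hordb⟩ := hbot
  have hMrR : Mr nb.primeFactors.card = 0 := hzero _ nb hnb rfl hadmb db hordb
  -- the annihilation one level down
  have hsub : ∀ (p : ℕ) (n : ℕ), Squarefree n →
      (∀ q ∈ n.primeFactors, (Zhang2014.IsKolyvaginPrime (W.conductorNorm ℤ) W K 2 q ∧ L ≤ Zhang2014.kolyvaginIndex W 2 q) ∧ G q) →
      n.primeFactors.card = p + 1 → ∀ ℓ ∈ n.primeFactors, ∀ e : KolyvaginHeegnerData Dt β ι (n / ℓ),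
        ((2 ^ (L - Mr p) : ℕ) : ℤ) • e.kolyvaginClass Nat.prime_two L = 0 := by
    intro p n hn hadm hcard ℓ hℓ e
    obtain ⟨hsq', hsubset, hcard'⟩ := squarefree_div_primeFactors' hn hℓ
    exact hkill p (n / ℓ) hsq' (by omega) (fun q hq ↦ hadm q (hsubset hq)) e
  -- the record clause at a drop `Mr (s+1) < Mr s`
  have hrecord : ∀ s : ℕ, Mr (s + 1) < Mr s →
      ∀ (i : ℕ) (u : Fin i → galH1Torsion (W.baseChange K) ((2 ^ L : ℕ) : ℤ)), i ≤ s + 1 →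
      (∀ j, u j ∈ selmerGroup (W.baseChange K) ((2 ^ L : ℕ) : ℤ) ∧
        conjAct W τ ((2 ^ L : ℕ) : ℤ) (u j) = (-W.rootNumber * (-1) ^ (s + 1)) • u j) →
      ∃ (n : ℕ) (_ : Squarefree n)
        (_ : ∀ q ∈ n.primeFactors, (Zhang2014.IsKolyvaginPrime (W.conductorNorm ℤ) W K 2 q ∧
          L ≤ Zhang2014.kolyvaginIndex W 2 q) ∧ G q)
        (_ : n.primeFactors.card = s + 1) (d : KolyvaginHeegnerData Dt β ι n),
        addOrderOf (d.kolyvaginClass Nat.prime_two L) = 2 ^ (L - Mr (s + 1)) ∧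
        Disjoint (zmultiples (((2 ^ (L - Mr s) : ℕ) : ℤ) • d.kolyvaginClass Nat.prime_two L))
          (AddSubgroup.closure (Set.range u)) := by
    intro s hdrop
    have hm : Mr (s + 1) < M₀ := lt_of_lt_of_le hdrop (hMrM₀ s)
    exact exists_recordLevel_avoiding_of_deepSwap W hQ2 hcm hT hρ hIQ hodd h3 hHe τ hτ Dt β ι G hL1 (by omega) hdrop
      ((hMrL s).trans le_rfl) (fun n e hn hcard hadm ↦ hkill (s + 1) n hn hcard hadm e)
      (fun n e hn hcard hadm ↦ hkill s n hn (by omega) hadm e) (hatt (s + 1))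
      (hswap (s + 1) (Mr (s + 1)) (by omega) hm (fun n e hn hcard hadm ↦ hkill (s + 1) n hn hcard hadm e)) (hK (s + 1))
  refine ⟨nb.primeFactors.card, Mr, hstep, hMr0, hMrR, fun m hm i u hi hu ↦ ?_, fun m hm i u hi hu ↦ ?_⟩
  · -- odd depth `2m + 1`, sign `w(E)`
    have hsign : -W.rootNumber * (-1) ^ (2 * m + 1) = W.rootNumber := by
      rw [Odd.neg_one_pow ⟨m, rfl⟩]
      ring
    obtain ⟨n, hn, hadm, hcard, d, hord, hdisj⟩ := hrecord (2 * m) hm i u hi (fun j ↦ by rw [hsign]; exact hu j)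
    refine ⟨n, hn, fun q hq ↦ ⟨(hadm q hq).1.1, (hadm q hq).1.2, (hadm q hq).2⟩, d, hsub (2 * m) n hn hadm hcard, hord, ?_, hdisj⟩
    rw [hcard]
    exact hsign
  · -- even depth `2m + 2`, sign `-w(E)`: McCallum's `C` generated by `u` AND the seed `c_L(1)`
    have hsign : -W.rootNumber * (-1) ^ (2 * m + 2) = -W.rootNumber := by
      rw [Even.neg_one_pow ⟨m + 1, by ring⟩]
      ring
    have hdiv : ∀ P : geomPoints (W.baseChange K), ∃ Q : geomPoints (W.baseChange K), ((2 ^ L : ℕ) : ℤ) • Q = P :=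
      (W.baseChange K).zsmul_geomPoints_surjective_of_charZero hn0
    obtain ⟨P₀, hP₀⟩ := McCallum1991.exists_map_eq_derivedPoint_one' hIQ d₁
    obtain ⟨hsel1, hc1, hsgn1⟩ := kummerMapTorsion_bottom_mem_selmerGroup_and_conjAct (W := W) (Dt := Dt) (β := β) (ι := ι)
      hIQ h3 hne4 hodd hHe hsurj1 τ hτ hL1 hdiv d₁ P₀ hP₀
    rw [← hc1] at hsel1 hsgn1
    obtain ⟨n, hn, hadm, hcard, d, hord, hdisj⟩ := hrecord (2 * m + 1) hm (i + 1)
      (Fin.cons (d₁.kolyvaginClass Nat.prime_two L) u) (by omega) (fun j ↦ by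
        rw [hsign]
        refine Fin.cases ?_ (fun j ↦ ?_) j
        · rw [Fin.cons_zero]
          exact ⟨hsel1, hsgn1⟩
        · rw [Fin.cons_succ]
          exact hu j)
    refine ⟨n, hn, fun q hq ↦ ⟨(hadm q hq).1.1, (hadm q hq).1.2, (hadm q hq).2⟩, d, hsub (2 * m + 1) n hn hadm hcard, hord, ?_, ?_⟩
    · rw [hcard]
      exact hsign
    · refine hdisj.mono_right (sup_le ?_ ?_)
      · exact closure_mono (by
          rintro x ⟨j, rfl⟩
          exact ⟨j.succ, Fin.cons_succ _ _ _⟩)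
      · exact zmultiples_le_of_mem (subset_closure ⟨0, Fin.cons_zero _ _⟩)

end Summit.BirchSwinnertonDyer.BirchSwinnertonDyer.Theorems.GenusExact.PlusDescent

end
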